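import Summits.BirchSwinnertonDyer.BirchSwinnertonDyer.Theorems.Rank1ResidualJetEigenQuotientCount
import HarnessLib

/-!
# T1 JET (cell `bsd-jet`), road K, input (L1): the `s`-part of an equivariant image — `#(κ(M) ∩ X^s) =
# #(M/ker κ)^s` (pure algebra), for the local Kummer image `Kum_λ = κ_λ(E(K_λ))`

HONEST FRAMING (programme file `BSD-LIT2PART-PROGRAMME-v1.md` §HONESTY, verbatim): «no tranche here
proves BSD; ARM L moves the LITERAL column of an r ≤ 1 census into the kernel-proved-modulo-named-print
column; ARM P changes what «named print» is worth.» THEOREMS ONLY (seat `bsd-jet-pv-1`, session g5;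
`--supports stmt-BirchSwinnertonDyer-14418`, helper): no definition, no named fact, no `sorry`.
Nothing is booked; 0 classes move.

## What

After `…KolyvaginLocalTermKummer` the Kolyvagin-prime local term of the row duality is
`#(Kum_λ ∩ ker(σ_{*,λ} − s))`, `Kum_λ = κ_λ(E(K_λ))` the image of the local Kummer map, which intertwines
the action of the Galois transport on `E(K_λ)` with `σ_{*,λ}`. This file supplies the algebra moving the
count to the SOURCE of `κ`: for `κ : M →+ X`, endomorphisms `τM`, `τX` with `κ ∘ τM = τX ∘ κ`, `τX` an
involution on the image... precisely: if `X` is killed by an odd `n` and `τX² = 1`, then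
`#(κ.range ∩ ker(τX − s)) = #ker(τ̄M − s)` on `M ⧸ κ.ker` (`natCard_range_inf_ker_eq`), where `τ̄M` is the
map induced by `τM` (which preserves `κ.ker`). With `κ.ker = p^k E(K_λ)` this is
`#(E(K_λ)/p^k E(K_λ))^{τ_λ = s}`, the form in which Jetchev's Lemma 5.2 (i) is computed from the
reduction `E(K_λ)/p^k ≅ Ẽ(𝔽_{ℓ²})/p^k` (`τ_λ ↦ Frob_ℓ`).

References (locators only): [cite: Jetchev2008, Lemma 5.2 (i) (p. 822)] [cite: GrossLMS1991, §4 (4.1)–(4.3)].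
Design: no definitions; `Type*`-polymorphic. Axioms: `propext`, `Classical.choice`, `Quot.sound`.
-/

set_option autoImplicit false

noncomputable section

open scoped Classical
open Function

namespace Summit.BirchSwinnertonDyer.Rank1Residual.JET.GlobalDuality

section ImageEigen

variable {M X : Type*} [AddCommGroup M] [AddCommGroup X] (κ : M →+ X) (τM : M →+ M) (τX : X →+ X)

/-- If `κ ∘ τM = τX ∘ κ` then `τM` preserves `ker κ`. -/
theorem ker_le_comap_of_comp_eq (h : ∀ m, κ (τM m) = τX (κ m)) : κ.ker ≤ κ.ker.comap τM := fun m hm => by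
  rw [AddSubgroup.mem_comap, AddMonoidHom.mem_ker, h, (AddMonoidHom.mem_ker).mp hm, map_zero]

/-- **`#(κ(M) ∩ X^s) = #(M/ker κ)^s`**: for `κ : M → X` intertwining `τM` with `τX`, the first
isomorphism theorem `M/ker κ ≅ κ(M)` matches the `s`-eigenclasses of the induced map `τ̄M` with
`κ(M) ∩ ker(τX − s)`. [cite: Jetchev2008, Lemma 5.2 (i) (p. 822)] -/
theorem natCard_range_inf_ker_eq (h : ∀ m, κ (τM m) = τX (κ m)) (s : ℤ) :
    Nat.card ↥(κ.range ⊓ (τX - s • AddMonoidHom.id X).ker) =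
      Nat.card ((QuotientAddGroup.map κ.ker κ.ker τM (ker_le_comap_of_comp_eq κ τM τX h) -
        s • AddMonoidHom.id (M ⧸ κ.ker)).ker) := by
  -- the first isomorphism theorem: `ψ : M/ker κ ↪ X` carries the eigenclasses onto `κ(M) ∩ X^s`
  have hmap : ((QuotientAddGroup.map κ.ker κ.ker τM (ker_le_comap_of_comp_eq κ τM τX h) -
        s • AddMonoidHom.id (M ⧸ κ.ker)).ker).map (QuotientAddGroup.kerLift κ) =
      κ.range ⊓ (τX - s • AddMonoidHom.id X).ker := by
    ext x
    constructor
    · rintro ⟨y, hy, rfl⟩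
      obtain ⟨m, rfl⟩ := QuotientAddGroup.mk_surjective y
      rw [SetLike.mem_coe, AddMonoidHom.mem_ker, AddMonoidHom.sub_apply, AddMonoidHom.smul_apply,
        AddMonoidHom.id_apply, QuotientAddGroup.map_mk, sub_eq_zero, ← QuotientAddGroup.mk_zsmul,
        QuotientAddGroup.eq, AddMonoidHom.mem_ker, map_add, map_neg, map_zsmul, h, neg_add_eq_zero] at hy
      rw [QuotientAddGroup.kerLift_mk]
      refine AddSubgroup.mem_inf.mpr ⟨⟨m, rfl⟩, ?_⟩
      rw [AddMonoidHom.mem_ker, AddMonoidHom.sub_apply, AddMonoidHom.smul_apply, AddMonoidHom.id_apply,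
        hy, sub_self]
    · intro hx'
      obtain ⟨⟨m, rfl⟩, hx⟩ := AddSubgroup.mem_inf.mp hx'
      rw [AddMonoidHom.mem_ker, AddMonoidHom.sub_apply, AddMonoidHom.smul_apply, AddMonoidHom.id_apply,
        sub_eq_zero] at hx
      refine ⟨QuotientAddGroup.mk m, ?_, QuotientAddGroup.kerLift_mk κ m⟩
      rw [SetLike.mem_coe, AddMonoidHom.mem_ker, AddMonoidHom.sub_apply, AddMonoidHom.smul_apply,
        AddMonoidHom.id_apply, QuotientAddGroup.map_mk, sub_eq_zero, ← QuotientAddGroup.mk_zsmul,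
        QuotientAddGroup.eq, AddMonoidHom.mem_ker, map_add, map_neg, map_zsmul, h, hx, neg_add_cancel]
  rw [← hmap, AddSubgroup.card_map_of_injective (QuotientAddGroup.kerLift_injective κ)]

end ImageEigen

end Summit.BirchSwinnertonDyer.Rank1Residual.JET.GlobalDuality

end
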